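import Summits.QuantumFields.QCD.Theses.HeatSlicedQuarks
import Literature.MathematicalPhysics.QuantumLattice.LatticeGaugeDLR

/-!
# Quark-loop coefficient (item stmt-QuantumFields-16786, route HeatSlicedQuarks): definitions

Proof-side objects used by the line `Sketch` of the crux `QuarkLoopCoefficient`
(`Summit.QuantumFields.QCD.Theses.HeatSlicedQuarks.QuarkLoopCoefficient`): the colour–spin traced
on-diagonal correction of the massless Wilson heat kernel in covariantly constant Cartan flux equals
`(1 − cos θ)/(3π²)` up to `Cθ²(1/t + θ²t²) + Ce^{−cL²/(t+L)}/t²`.  No statement of the route is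
restated here; these are proof-side abbreviations only.

The line works on the universal cover `ℤ⁴` of the torus, per colour (the links are diagonal, so the
three colours decouple into `U(1)` problems of charges `θ, −θ, 0`), in the SYMMETRIC gauge, where the
squared Wilson–Dirac operator commutes with magnetic translations and is therefore determined by its
`0`-row (its "symbol"):

* `ℤ⁴` geometry: `wedge v w = v₀w₁ − v₁w₀`, the range-one / range-two neighbourhoods `nbr`, `nbr2`,
  the Euclidean length `elen`;
* the symmetric-gauge abelian link field `symLink θ` (`A₀ = −z₁/2`, `A₁ = z₀/2`, plaquette `e^{iθ}`
  in the `(0,1)` plane, all other plaquettes trivial) and, for any complex link field `u` on `ℤ⁴`,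
  the massless `r = 1` abelian Wilson–Dirac KERNEL `diracKer u x y` (a `4 × 4` spin matrix; the
  formula of the tree's `wilsonDirac` with `ρ(U e)⁻¹` written as `conj (u e)`, which is the inverse
  for unimodular links), its square `sqKer u = D♯D`, the kernel powers `sqKerPow u n` (finite sums:
  `sqKer` has range two) and the heat kernel `heatKer u t x y = Σₙ (−t)ⁿ/n! (D♯D)ⁿ(x,y)` on `ℤ⁴`
  (absolutely convergent exponential series; no operator theory is needed); the symmetric-gauge heat
  symbol `symHeat θ t w = heatKer (symLink θ) t 0 w`;
* the free objects: the free Wilson symbol `hsymb p = Σ sin² p_μ + (Σ (1 − cos p_μ))²` (the tree's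
  symbol of `freeKernelPowerCounting_proof`), the Brillouin zone `brillouin = [−π,π]⁴`, the free heat
  kernel on `ℤ⁴` as a Brillouin-zone integral `freeKer t w = (2π)⁻⁴ ∫ e^{−t h(p)} cos(p·w) dp`, the
  Fourier coefficients `hhat` of `h` (`20` at `0`, `−4` at `±e_μ`, `1/2` at `±e_μ ± e_ν`, `μ ≠ ν`),
  and the two-regime Gaussian majorant `gaussProfile c t w = (1+t)⁻² exp(−c|w|²/(1 + t + |w|))`
  (Davies' profile with the free on-diagonal prefactor `t⁻²`);
* the second-order perturbation objects of the Peierls-dressed (twisted-convolution) expansion of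
  `symHeat` around the free kernel: the free Dirac symbol `dsymb`, its adjoint symbol `dsharp`, the
  order-`j` vertex `vtx j` (the `θʲ`-coefficient of `f ↦ ȟ_θ ⋆_θ f`, `ȟ_θ = ď♯ ⋆_θ ď`, with the
  cocycle `e^{(iθ/2)(z∧v + v∧w)}` expanded), the free convolution `freeConv`, the zeroth and first
  order terms `pert0`, `pert1`, and the spin-traced second-order coefficient at the origin `e2 t`
  (the number the crux pins: `e2 t → 1/(12π²)` as `t → ∞`, per unit charge);
* torus-side: the colour charges
  `charge a θ ∈ {θ, −θ, 0}` of the Cartan embedding `diag(e^{iθ}, e^{−iθ}, 1)`, and the massless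
  torus heat kernel `torusHeat U t = exp(−t D_W(U,0,1)ᴴ D_W(U,0,1))`.

Proofs live in the sibling files `HeatSlicedQuarksQuarkLoopCoefficient*.lean` (stubs of the line,
see `Cruxes/QuarkLoopCoefficient/Lines/Sketch.lean`).  Mathlib + the tree's `wilsonDirac`,
`euclideanGamma`, `plaquetteHolonomy`, `Site`, `LGConfig`; no named facts.
-/

noncomputable section

namespace Summit.QuantumFields.QCD.Theorems.QuarkLoopCoefficient

open Literature.MathematicalPhysics.QuantumLattice Literature.MathematicalPhysics.QuantumFieldTheory
open Literature.Probability.LatticeModels (Site TorusSite)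
open scoped Matrix ComplexConjugate

/-- Spin matrices: `4 × 4` complex matrices acting on the Dirac index. -/
abbrev Spin : Type := Matrix (Fin 4) (Fin 4) ℂ

/-! ## Geometry of `ℤ⁴` -/

/-- The antisymmetric form `v ∧ w = v₀ w₁ − v₁ w₀` of the `(0,1)` plane (the flux plane of the
crux); `(θ/2) · v ∧ w` is the phase of the magnetic-translation cocycle in the symmetric gauge. -/
def wedge (v w : Site 4) : ℤ := v 0 * w 1 - v 1 * w 0

/-- The range-one neighbourhood of `x` in `ℤ⁴`: `x` and `x ± e_μ` (the support of the `x`-row of the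
Wilson–Dirac kernel). -/
def nbr (x : Site 4) : Finset (Site 4) :=
  insert x (Finset.univ.biUnion fun μ : Fin 4 => {x + Pi.single μ 1, x - Pi.single μ 1})

/-- The range-two neighbourhood of `x` in `ℤ⁴` (the support of the `x`-row of `D♯D`). -/
def nbr2 (x : Site 4) : Finset (Site 4) := (nbr x).biUnion nbr

/-- The Euclidean length `|w| = √(Σ_μ w_μ²)` of a lattice vector. -/
def elen (w : Site 4) : ℝ := Real.sqrt (∑ μ : Fin 4, ((w μ : ℤ) : ℝ) ^ 2)

/-! ## The symmetric gauge and the abelian Wilson–Dirac kernel on `ℤ⁴` -/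

/-- The symmetric-gauge vector potential of unit flux in the `(0,1)` plane:
`A₀(z) = −z₁/2`, `A₁(z) = z₀/2`, `A₂ = A₃ = 0`. -/
def symPotential (z : Site 4) (μ : Fin 4) : ℝ :=
  if μ = 0 then -((z 1 : ℤ) : ℝ) / 2 else if μ = 1 then ((z 0 : ℤ) : ℝ) / 2 else 0

/-- The symmetric-gauge `U(1)` link field of flux `θ` on `ℤ⁴`: `u(z, μ) = exp(i θ A_μ(z))`; its
plaquette is `e^{iθ}` in the `(0,1)` plane and `1` in every other plane. -/
def symLink (θ : ℝ) : LGConfig 4 ℂ :=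
  fun e => Complex.exp (((θ * symPotential e.1 e.2 : ℝ) : ℂ) * Complex.I)

/-- The massless (`m = 0`), `r = 1` abelian Wilson–Dirac kernel on `ℤ⁴` for a complex link field
`u`: `D(x,y) = 4 δ_{xy} − ½ Σ_μ [ (1 − γ_μ) u(x,μ) δ_{y,x+e_μ} + (1 + γ_μ) conj(u(y,μ)) δ_{x,y+e_μ} ]`
— the formula of the tree's torus operator `wilsonDirac ρ U 0 1` (colour block of a diagonal link
field) with the backward link `ρ(U(y,μ))⁻¹` written as the complex conjugate (equal to the inverse
for unimodular links). -/
def diracKer (u : LGConfig 4 ℂ) (x y : Site 4) : Spin :=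
  (if x = y then (4 : ℂ) • (1 : Spin) else 0) -
    (1 / 2 : ℂ) • ∑ μ : Fin 4,
      ((if y = x + Pi.single μ 1 then u (x, μ) • ((1 : Spin) - euclideanGamma μ) else 0) +
        (if x = y + Pi.single μ 1 then conj (u (y, μ)) • ((1 : Spin) + euclideanGamma μ) else 0))

/-- The kernel of the squared operator `H = D♯ D`: `H(x,y) = Σ_z D(z,x)ᴴ D(z,y)` (the sum runs over
the range-one neighbourhood of `x`, outside which `D(z,x) = 0`). -/
def sqKer (u : LGConfig 4 ℂ) (x y : Site 4) : Spin :=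
  ∑ z ∈ nbr x, (diracKer u z x)ᴴ * diracKer u z y

/-- The kernel powers `Hⁿ(x,y)` (finite sums: `H` has range two). -/
def sqKerPow (u : LGConfig 4 ℂ) : ℕ → Site 4 → Site 4 → Spin
  | 0 => fun x y => if x = y then 1 else 0
  | n + 1 => fun x y => ∑ z ∈ nbr2 x, sqKer u x z * sqKerPow u n z y

/-- The heat kernel `e^{−tH}(x,y) = Σₙ (−t)ⁿ/n! · Hⁿ(x,y)` of the abelian Wilson operator on `ℤ⁴`
(entrywise absolutely convergent exponential series; for a bounded link field `|Hⁿ(x,y)| ≤ Cⁿ`). -/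
def heatKer (u : LGConfig 4 ℂ) (t : ℝ) (x y : Site 4) : Spin :=
  ∑' n : ℕ, (((-t) ^ n / (n.factorial : ℝ) : ℝ) : ℂ) • sqKerPow u n x y

/-- The symmetric-gauge heat symbol of flux `θ`: the `0`-row `E_t^{(θ)}(w) = e^{−tH_θ}(0, w)` of the
heat kernel of `symLink θ`; by magnetic-translation covariance
`e^{−tH_θ}(x, y) = e^{(iθ/2) x∧y} E_t^{(θ)}(y − x)`. -/
def symHeat (θ t : ℝ) (w : Site 4) : Spin := heatKer (symLink θ) t 0 w

/-! ## The free kernel as a Brillouin-zone integral -/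

/-- The free massless `r = 1` Wilson symbol `h(p) = Σ_μ sin² p_μ + (Σ_μ (1 − cos p_μ))²` (the scalar
symbol of `D♯D` for trivial links; it vanishes on `[−π,π]⁴` only at `p = 0`). -/
def hsymb (p : Fin 4 → ℝ) : ℝ :=
  (∑ μ : Fin 4, Real.sin (p μ) ^ 2) + (∑ μ : Fin 4, (1 - Real.cos (p μ))) ^ 2

/-- The Brillouin zone `[−π, π]⁴`. -/
def brillouin : Set (Fin 4 → ℝ) := Set.pi Set.univ fun _ => Set.Icc (-Real.pi) Real.pi

/-- The free heat kernel on `ℤ⁴`: `k_t(w) = (2π)⁻⁴ ∫_{[−π,π]⁴} e^{−t h(p)} cos(p · w) dp`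
(real and even in `w`; `k_0 = δ₀`). -/
def freeKer (t : ℝ) (w : Site 4) : ℝ :=
  ((2 * Real.pi)⁻¹) ^ 4 *
    ∫ p in brillouin, Real.exp (-(t * hsymb p)) * Real.cos (∑ μ : Fin 4, p μ * ((w μ : ℤ) : ℝ))

/-- The Fourier coefficients `ĥ` of the free symbol, `h(p) = Σ_z ĥ(z) cos(p · z)`:
`ĥ(0) = 20`, `ĥ(±e_μ) = −4`, `ĥ(±e_μ ± e_ν) = 1/2` for `μ ≠ ν`, and `0` otherwise (in particular no
`±2e_μ` coefficient). -/
def hhat (z : Site 4) : ℝ :=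
  if z = 0 then 20
  else if (∑ μ : Fin 4, |z μ|) = 1 then -4
  else if (∑ μ : Fin 4, |z μ|) = 2 ∧ (∀ μ : Fin 4, |z μ| ≤ 1) then 1 / 2
  else 0

/-- The two-regime Gaussian majorant with the free on-diagonal prefactor:
`Γ_c(t, w) = (1 + t)⁻² exp(−c |w|² / (1 + t + |w|))` (Gaussian `e^{−c|w|²/t}` for `|w| ≲ t`,
exponential `e^{−c|w|}` beyond; Davies 1993). -/
def gaussProfile (c t : ℝ) (w : Site 4) : ℝ :=
  ((1 + t) ^ 2)⁻¹ * Real.exp (-(c * elen w ^ 2 / (1 + t + elen w)))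

/-! ## Second-order perturbation theory of the heat symbol in the flux

In the symmetric gauge every kernel `K` of the theory is magnetic-translation covariant,
`K(x+v, y+v) = e^{(iθ/2) v∧(y−x)} K(x,y)`, hence determined by its symbol `f(w) = K(0,w)`; products
become twisted convolutions `(f ⋆_θ g)(w) = Σ_z e^{(iθ/2) z∧w} f(z) g(w − z)`.  The free Dirac symbol
`ď` is `θ`-independent, `H_θ` has symbol `ȟ_θ = ď♯ ⋆_θ ď`, and `E_t = symHeat θ t` solves
`∂_t E = −ȟ_θ ⋆_θ E`, `E_0 = δ₀`.  Expanding the cocycle in `θ` gives the vertices `vtx j` and the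
formal expansion `E = Σ θʲ E_j` with `E₀ = k_t · 1`, `E₁(t) = −∫₀ᵗ k_{t−s} ∗ vtx 1 (E₀(s)) ds`,
`E₂(t) = −∫₀ᵗ k_{t−s} ∗ [vtx 2 (E₀(s)) + vtx 1 (E₁(s))] ds`. -/

/-- The free Dirac symbol `ď(w) = D(0, w)` for trivial links (`4` at `0`, `−½(1 − γ_μ)` at `e_μ`,
`−½(1 + γ_μ)` at `−e_μ`); in the symmetric gauge it is also the symbol of `D_θ` for every `θ`. -/
def dsymb (w : Site 4) : Spin := diracKer (fun _ => 1) 0 w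

/-- The adjoint symbol `ď♯(w) = ď(−w)ᴴ` (symbol of `D♯`). -/
def dsharp (w : Site 4) : Spin := (dsymb (-w))ᴴ

/-- The order-`j` vertex: the `θʲ`-coefficient of `f ↦ ȟ_θ ⋆_θ f`,
`(vtx j f)(w) = Σ_{v,z} ((i/2)(z∧v + v∧w))ʲ/j! · ď♯(z) ď(v − z) f(w − v)`
(`z` of range one, `v` of range two). -/
def vtx (j : ℕ) (f : Site 4 → Spin) (w : Site 4) : Spin :=
  ∑ v ∈ nbr2 0, ∑ z ∈ nbr 0,
    ((Complex.I / 2 * ((wedge z v + wedge v w : ℤ) : ℂ)) ^ j / (j.factorial : ℂ)) •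
      (dsharp z * dsymb (v - z) * f (w - v))

/-- Free convolution of a spin-matrix valued function with the free kernel:
`(k_t ∗ f)(w) = Σ_y k_t(w − y) f(y)`. -/
def freeConv (t : ℝ) (f : Site 4 → Spin) (w : Site 4) : Spin :=
  ∑' y : Site 4, ((freeKer t (w - y) : ℝ) : ℂ) • f y

/-- The zeroth-order term `E₀(s) = k_s · 1`. -/
def pert0 (s : ℝ) (w : Site 4) : Spin := ((freeKer s w : ℝ) : ℂ) • (1 : Spin)

/-- The first-order term `E₁(s) = −∫₀ˢ k_{s−r} ∗ vtx 1 (E₀(r)) dr` (entrywise interval integral). -/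
def pert1 (s : ℝ) (w : Site 4) : Spin :=
  Matrix.of fun α β => -∫ r in (0 : ℝ)..s, freeConv (s - r) (vtx 1 (pert0 r)) w α β

/-- The spin-traced second-order coefficient of the heat symbol at the origin,
`e2 t = tr E₂(t)(0) = −∫₀ᵗ Σ_w k_{t−s}(w) · tr[(vtx 2 (E₀(s)))(w) + (vtx 1 (E₁(s)))(w)] ds`
(the free kernel is even, `k(−w) = k(w)`).  This is the `θ²`-coefficient, per unit charge, of the
spin-traced on-diagonal heat kernel; the crux pins its large-`t` limit `1/(12π²)`. -/
def e2 (t : ℝ) : ℂ :=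
  -∫ s in (0 : ℝ)..t, ∑' w : Site 4,
    ((freeKer (t - s) w : ℝ) : ℂ) * ((vtx 2 (pert0 s) w).trace + (vtx 1 (pert1 s) w).trace)

/-! ## Torus side -/

/-- The colour charges of the Cartan embedding `diag(e^{iθ}, e^{−iθ}, 1)`: colour `0` carries flux
`θ`, colour `1` flux `−θ`, colour `2` none. -/
def charge (a : Fin 3) (θ : ℝ) : ℝ := if a = 0 then θ else if a = 1 then -θ else 0

/-- The massless (`m = 0`, `r = 1`) Wilson heat kernel of the torus, `exp(−t D_Wᴴ D_W)`, as in the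
crux. -/
abbrev torusHeat {L : ℕ} [NeZero L] (U : GaugeConfig 4 L (Matrix.specialUnitaryGroup (Fin 3) ℂ)) (t : ℝ) :
    Matrix (TorusSite 4 L × Fin 3 × Fin 4) (TorusSite 4 L × Fin 3 × Fin 4) ℂ :=
  NormedSpace.exp (-(t : ℂ) •
    (Matrix.conjTranspose (wilsonDirac (fundamentalRep (Fin 3)) U 0 1) *
      wilsonDirac (fundamentalRep (Fin 3)) U 0 1))

end Summit.QuantumFields.QCD.Theorems.QuarkLoopCoefficient

end
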